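import Summits.ResolutionOfSingularities.ResolutionOfSingularities.Theorems.PurelyInseparableDim4JointInstance
import Literature.AlgebraicGeometry.Resolution.PointBlowupMohBound
import HarnessLib

/-!
# Purely inseparable four-folds: computations for the TWO-CHART instance `z^p + x₁^{2p} x₃ + (x₂ − x₁)^p x₄` of the
# monotone joint forest (brick S3 (c) «joint point∘coordinate chains», part 22a, cell `res-dim4-pi`)

[OURS · counted 0] (D-0157 DOOR 2; desk WORD #66 (4)(c), #74 (g), #99 (d); frame `PIDim4.TerminationImpliesOrderReduction`,
S3 (c); host item stmt-ResolutionOfSingularities-16155, helper). Nothing here proves resolution of singularities in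
dimension ≥ 4 / characteristic `p` — NOT here, not anywhere in this programme.

`F = x₁^{2p} x₃ + (x₂ − x₁)^p x₄`, `K` of characteristic `p`. §1: linear coefficients of `F(x + b)` are values of partial
derivatives (`coeff_single_one_translate`, via `coeff_single_one_eq_constantCoeff_pderiv` and the tree's
`PointBlowup.pderiv_translate`). §2: `F` is clean, non-zero, `V(z, x₁, x₂)` permissible; its `x₁`-chart transform is
`y₁^p y₃ + (y₂^p − 1) y₄` and its `x₂`-chart transform `y₁^{2p} y₂^p y₃ + (1 − y₁^p) y₄`; the root order-`p` points have
`x₁ = x₂ = 0` (`roots_inst₄`); in the `x₁`-chart the equimultiple points have `y₂ = 1` (`eq_one_of_isEquimultiplePoint_inst₄`)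
and the entry `(x₁, (0,1,0,0))` is equimultiple with child equation part 5's `x₁^p x₃ + x₂^p x₄` (`step_F_inst₄`); in the
`x₂`-chart NO pair with `y₁ = 0` is equimultiple (`not_isEquimultiplePoint_inst₄_one`) — the equimultiple points there
(`y₁ = 1`) are the child seen a second time. The certificate is part 22b (`…JointForestTwoChartInstance`).

AI-produced formalisation, weaker than expert review. bears_on: LADDER-RESOLUTION:D157-DOOR2 (res-dim4-pi · S3 (c) joint v2 ·
two-chart instance, computations).
-/

set_option linter.dupNamespace false -- D-0017: single-problem summit path `Summit.<S>.<S>.…` by design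

noncomputable section

open MvPolynomial Finset CategoryTheory AlgebraicGeometry Opposite TopologicalSpace

namespace Summit.ResolutionOfSingularities.ResolutionOfSingularities.Theorems.PIDim4

open Literature.AlgebraicGeometry.Resolution
open Literature.AlgebraicGeometry.Resolution.Hauser2010
open Literature.AlgebraicGeometry.Resolution.AffinePointBlowup (P A γ coord Wtop ξ)

namespace Equimultiple

/-! ## §1 Linear coefficients of a translate are values of partial derivatives -/

section Linear

variable {K : Type} [Field K] {p : ℕ} [hp : Fact p.Prime]

omit hp in
/-- The coefficient of `x_i` is the constant term of `∂/∂x_i`. [folklore] -/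
theorem coeff_single_one_eq_constantCoeff_pderiv {σ : Type*} [DecidableEq σ] (i : σ) (f : MvPolynomial σ K) :
    coeff (Finsupp.single i 1) f = constantCoeff (pderiv i f) := by
  induction f using MvPolynomial.induction_on' with
  | monomial d a =>
    rw [pderiv_monomial, constantCoeff_monomial, coeff_monomial]
    by_cases hd : d = Finsupp.single i 1
    · subst hd
      simp
    · rw [if_neg hd]
      split_ifs with h
      · have hle : d ≤ Finsupp.single i 1 := tsub_eq_zero_iff_le.mp h
        have hdi : d i = 0 := by
          have h1 : d i ≤ 1 := by simpa using hle i
          rcases Nat.le_one_iff_eq_zero_or_eq_one.mp h1 with h0 | h1'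
          · exact h0
          · exfalso
            apply hd
            ext k
            by_cases hki : k = i
            · subst hki; simp [h1']
            · have := hle k
              simp [Ne.symm hki] at this
              simp [Ne.symm hki, this]
        simp [hdi]
      · rfl
  | add f g hf hg => rw [coeff_add, map_add, map_add, hf, hg]

omit hp in
/-- **The coefficient of `x_i` in `F(x + b)` is `(∂F/∂x_i)(b)`.** [folklore] -/
theorem coeff_single_one_translate (b : Fin 4 → K) (i : Fin 4) (F : MvPolynomial (Fin 4) K) :
    coeff (Finsupp.single i 1) (PointBlowup.translate b F) = eval b (pderiv i F) := by
  rw [coeff_single_one_eq_constantCoeff_pderiv, PointBlowup.pderiv_translate, constantCoeff_eq, coeff_zero_translate]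

/-- If every non-constant monomial of degree `< p` of `F(x + b)` vanishes then every partial derivative of `F` vanishes
at `b` (`p ≥ 2`). [folklore] -/
theorem eval_pderiv_eq_zero_of_forall_coeff (b : Fin 4 → K) (F : MvPolynomial (Fin 4) K)
    (H : ∀ d : Fin 4 →₀ ℕ, d ≠ 0 → d.degree < p → coeff d (PointBlowup.translate b F) = 0) (i : Fin 4) :
    eval b (pderiv i F) = 0 := by
  rw [← coeff_single_one_translate]
  exact H _ (Finsupp.single_ne_zero.mpr one_ne_zero) (by rw [Finsupp.degree_single]; exact hp.out.one_lt)

end Linear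

/-! ## §2 Computations for `F = x₁^{2p} x₃ + (x₂ − x₁)^p x₄` and the member `(0, {x₁, x₂})` -/

section Instance₄

variable {K : Type} [Field K] {p : ℕ} [hp : Fact p.Prime] [CharP K p]

/-- `F` as a sum of three monomials (`(x₂ − x₁)^p = x₂^p − x₁^p`). [folklore] -/
theorem inst₄_eq_monomial_add :
    (X 0 ^ (2 * p) * X 2 + (X 1 - X 0) ^ p * X 3 : MvPolynomial (Fin 4) K) =
      monomial (Finsupp.single 0 (2 * p) + Finsupp.single 2 1) 1 + monomial (Finsupp.single 1 p + Finsupp.single 3 1) 1 +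
        monomial (Finsupp.single 0 p + Finsupp.single 3 1) (-1) := by
  rw [sub_pow_char, sub_mul, X_pow_mul_X_eq_monomial, X_pow_mul_X_eq_monomial, X_pow_mul_X_eq_monomial, map_neg]
  abel

/-- The support of `F` lies in its three exponents. [folklore] -/
theorem mem_support_inst₄ {d : Fin 4 →₀ ℕ}
    (hd : d ∈ (X 0 ^ (2 * p) * X 2 + (X 1 - X 0) ^ p * X 3 : MvPolynomial (Fin 4) K).support) :
    d = Finsupp.single 0 (2 * p) + Finsupp.single 2 1 ∨ d = Finsupp.single 1 p + Finsupp.single 3 1 ∨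
      d = Finsupp.single 0 p + Finsupp.single 3 1 := by
  rw [inst₄_eq_monomial_add] at hd
  rcases Finset.mem_union.mp (Finset.mem_of_subset MvPolynomial.support_add hd) with hd' | hd'
  · rcases Finset.mem_union.mp (Finset.mem_of_subset MvPolynomial.support_add hd') with hd'' | hd''
    · exact Or.inl (Finset.mem_singleton.mp (Finset.mem_of_subset support_monomial_subset hd''))
    · exact Or.inr (Or.inl (Finset.mem_singleton.mp (Finset.mem_of_subset support_monomial_subset hd'')))
  · exact Or.inr (Or.inr (Finset.mem_singleton.mp (Finset.mem_of_subset support_monomial_subset hd')))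

omit hp in
/-- The three exponents are pairwise distinct (in the order needed). [folklore] -/
theorem inst₄_exponents_ne (hp0 : p ≠ 0) :
    (Finsupp.single 0 (2 * p) + Finsupp.single 2 1 : Fin 4 →₀ ℕ) ≠ Finsupp.single 1 p + Finsupp.single 3 1 ∧
      (Finsupp.single 0 (2 * p) + Finsupp.single 2 1 : Fin 4 →₀ ℕ) ≠ Finsupp.single 0 p + Finsupp.single 3 1 ∧
      (Finsupp.single 1 p + Finsupp.single 3 1 : Fin 4 →₀ ℕ) ≠ Finsupp.single 0 p + Finsupp.single 3 1 := by
  refine ⟨fun h => ?_, fun h => ?_, fun h => ?_⟩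
  · have := DFunLike.congr_fun h 2; simp at this
  · have := DFunLike.congr_fun h 2; simp at this
  · have := DFunLike.congr_fun h 1; simp at this; exact hp0 this

/-- The coefficient of `x₁^{2p} x₃` in `F` is `1`. [folklore] -/
theorem coeff_inst₄_lead :
    coeff (Finsupp.single (0 : Fin 4) (2 * p) + Finsupp.single 2 1)
      (X 0 ^ (2 * p) * X 2 + (X 1 - X 0) ^ p * X 3 : MvPolynomial (Fin 4) K) = 1 := by
  obtain ⟨h12, h13, -⟩ := inst₄_exponents_ne hp.out.ne_zero
  rw [inst₄_eq_monomial_add, coeff_add, coeff_add, coeff_monomial, if_pos rfl, coeff_monomial, if_neg (Ne.symm h12),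
    coeff_monomial, if_neg (Ne.symm h13), add_zero, add_zero]

/-- `F ≠ 0`. [folklore] -/
theorem inst₄_ne_zero : (X 0 ^ (2 * p) * X 2 + (X 1 - X 0) ^ p * X 3 : MvPolynomial (Fin 4) K) ≠ 0 := by
  intro h
  have hc := coeff_inst₄_lead (K := K) (p := p)
  rw [h, coeff_zero] at hc
  exact zero_ne_one hc

/-- `F` is clean (each monomial has an exponent `1`). [cite: HauserPerlega2019PRIMS, §2 (cleaning)] -/
theorem isClean_inst₄ :
    Literature.Barriers.ResolutionOfSingularities.HauserPerlega.IsClean p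
      (X 0 ^ (2 * p) * X 2 + (X 1 - X 0) ^ p * X 3 : MvPolynomial (Fin 4) K) := by
  intro d hd hpth
  rcases mem_support_inst₄ hd with rfl | rfl | rfl
  · have h0 : (Finsupp.single 0 (2 * p) + Finsupp.single 2 1 : Fin 4 →₀ ℕ) 2 = 1 := by simp
    have h := hpth 2 (by rw [Finsupp.mem_support_iff, h0]; exact one_ne_zero)
    rw [h0] at h
    exact hp.out.one_lt.ne' (Nat.dvd_one.mp h)
  · have h0 : (Finsupp.single 1 p + Finsupp.single 3 1 : Fin 4 →₀ ℕ) 3 = 1 := by simp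
    have h := hpth 3 (by rw [Finsupp.mem_support_iff, h0]; exact one_ne_zero)
    rw [h0] at h
    exact hp.out.one_lt.ne' (Nat.dvd_one.mp h)
  · have h0 : (Finsupp.single 0 p + Finsupp.single 3 1 : Fin 4 →₀ ℕ) 3 = 1 := by simp
    have h := hpth 3 (by rw [Finsupp.mem_support_iff, h0]; exact one_ne_zero)
    rw [h0] at h
    exact hp.out.one_lt.ne' (Nat.dvd_one.mp h)

/-- **`V(z, x₁, x₂)` is Hironaka-permissible for `z^p + F`.** [cite: HauserPerlega2019PRIMS, §2 (condition (1))] -/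
theorem isPermissibleCentre_inst₄ :
    IsPermissibleCentre p ({0, 1} : Finset (Fin 4)) (X 0 ^ (2 * p) * X 2 + (X 1 - X 0) ^ p * X 3 : MvPolynomial (Fin 4) K) := by
  refine ⟨⟨0, Finset.mem_insert_self _ _⟩, Finset.le_inf fun d hd => ?_⟩
  rcases mem_support_inst₄ hd with rfl | rfl | rfl <;> simp [degIn_pair]
  exact_mod_cast (by omega : p ≤ 2 * p)

/-- **The `x₁`-chart transform of `F` is `y₁^p y₃ + (y₂^p − 1) y₄`.** [cite: HauserPerlega2019PRIMS, §2 (the x₁-chart)] -/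
theorem chartTransform_inst₄_zero :
    CentreBlowup.chartTransform p ({0, 1} : Finset (Fin 4)) 0
        (X 0 ^ (2 * p) * X 2 + (X 1 - X 0) ^ p * X 3 : MvPolynomial (Fin 4) K) =
      X 0 ^ p * X 2 + (X 1 ^ p - 1) * X 3 := by
  rw [inst₄_eq_monomial_add, CentreBlowup.chartTransform_add, CentreBlowup.chartTransform_monomial_add_monomial,
    CentreBlowup.chartTransform_monomial, CentreBlowup.chartExponent, CentreBlowup.chartExponent,
    CentreBlowup.chartExponent, degIn_pair, degIn_pair, degIn_pair]
  have e1 : (Finsupp.single 0 (2 * p) + Finsupp.single 2 1 : Fin 4 →₀ ℕ).update 0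
      ((Finsupp.single 0 (2 * p) + Finsupp.single 2 1 : Fin 4 →₀ ℕ) 0 +
        (Finsupp.single 0 (2 * p) + Finsupp.single 2 1 : Fin 4 →₀ ℕ) 1 - p) = Finsupp.single 0 p + Finsupp.single 2 1 := by
    ext i; fin_cases i <;> simp [Finsupp.update_apply]
    omega
  have e2 : (Finsupp.single 1 p + Finsupp.single 3 1 : Fin 4 →₀ ℕ).update 0
      ((Finsupp.single 1 p + Finsupp.single 3 1 : Fin 4 →₀ ℕ) 0 +
        (Finsupp.single 1 p + Finsupp.single 3 1 : Fin 4 →₀ ℕ) 1 - p) = Finsupp.single 1 p + Finsupp.single 3 1 := by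
    ext i; fin_cases i <;> simp [Finsupp.update_apply]
  have e3 : (Finsupp.single 0 p + Finsupp.single 3 1 : Fin 4 →₀ ℕ).update 0
      ((Finsupp.single 0 p + Finsupp.single 3 1 : Fin 4 →₀ ℕ) 0 +
        (Finsupp.single 0 p + Finsupp.single 3 1 : Fin 4 →₀ ℕ) 1 - p) = Finsupp.single 3 1 := by
    ext i; fin_cases i <;> simp [Finsupp.update_apply]
  rw [e1, e2, e3, ← X_pow_mul_X_eq_monomial, ← X_pow_mul_X_eq_monomial, map_neg, show
    (monomial (Finsupp.single 3 1) (1 : K) : MvPolynomial (Fin 4) K) = X 3 from rfl]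
  ring

/-- **The `x₂`-chart transform of `F` is `y₁^{2p} y₂^p y₃ + (1 − y₁^p) y₄`.** [cite: HauserPerlega2019PRIMS, §2 (the x₁-chart)] -/
theorem chartTransform_inst₄_one :
    CentreBlowup.chartTransform p ({0, 1} : Finset (Fin 4)) 1
        (X 0 ^ (2 * p) * X 2 + (X 1 - X 0) ^ p * X 3 : MvPolynomial (Fin 4) K) =
      X 0 ^ (2 * p) * X 1 ^ p * X 2 + (1 - X 0 ^ p) * X 3 := by
  rw [inst₄_eq_monomial_add, CentreBlowup.chartTransform_add, CentreBlowup.chartTransform_monomial_add_monomial,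
    CentreBlowup.chartTransform_monomial, CentreBlowup.chartExponent, CentreBlowup.chartExponent,
    CentreBlowup.chartExponent, degIn_pair, degIn_pair, degIn_pair]
  have e1 : (Finsupp.single 0 (2 * p) + Finsupp.single 2 1 : Fin 4 →₀ ℕ).update 1
      ((Finsupp.single 0 (2 * p) + Finsupp.single 2 1 : Fin 4 →₀ ℕ) 0 +
        (Finsupp.single 0 (2 * p) + Finsupp.single 2 1 : Fin 4 →₀ ℕ) 1 - p) =
        Finsupp.single 0 (2 * p) + Finsupp.single 1 p + Finsupp.single 2 1 := by
    ext i; fin_cases i <;> simp [Finsupp.update_apply]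
    omega
  have e2 : (Finsupp.single 1 p + Finsupp.single 3 1 : Fin 4 →₀ ℕ).update 1
      ((Finsupp.single 1 p + Finsupp.single 3 1 : Fin 4 →₀ ℕ) 0 +
        (Finsupp.single 1 p + Finsupp.single 3 1 : Fin 4 →₀ ℕ) 1 - p) = Finsupp.single 3 1 := by
    ext i; fin_cases i <;> simp [Finsupp.update_apply]
  have e3 : (Finsupp.single 0 p + Finsupp.single 3 1 : Fin 4 →₀ ℕ).update 1
      ((Finsupp.single 0 p + Finsupp.single 3 1 : Fin 4 →₀ ℕ) 0 +
        (Finsupp.single 0 p + Finsupp.single 3 1 : Fin 4 →₀ ℕ) 1 - p) = Finsupp.single 0 p + Finsupp.single 3 1 := by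
    ext i; fin_cases i <;> simp [Finsupp.update_apply]
  rw [e1, e2, e3, map_neg, ← X_pow_mul_X_eq_monomial, show
    (monomial (Finsupp.single 3 1) (1 : K) : MvPolynomial (Fin 4) K) = X 3 from rfl,
    show (monomial (Finsupp.single 0 (2 * p) + Finsupp.single 1 p + Finsupp.single 2 1) (1 : K) : MvPolynomial (Fin 4) K) =
      X 0 ^ (2 * p) * X 1 ^ p * X 2 by
        rw [X_pow_eq_monomial, X_pow_eq_monomial, X, monomial_mul, monomial_mul, mul_one, mul_one]]
  ring

omit [CharP K p] in
/-- **The root parameters lie on the member**: order `p` at `(a, b)` forces `b₁ = b₂ = 0` (`∂F/∂x₃ = x₁^{2p}`,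
`∂F/∂x₄ = (x₂ − x₁)^p`). [cite: Hauser2010, §F (equiconstant points)] -/
theorem roots_inst₄ (b : Fin 4 → K)
    (H : ∀ d : Fin 4 →₀ ℕ, d ≠ 0 → d.degree < p →
      coeff d (PointBlowup.translate b (X 0 ^ (2 * p) * X 2 + (X 1 - X 0) ^ p * X 3 : MvPolynomial (Fin 4) K)) = 0) :
    b 0 = 0 ∧ b 1 = 0 := by
  have h2 := eval_pderiv_eq_zero_of_forall_coeff b _ H 2
  have h3 := eval_pderiv_eq_zero_of_forall_coeff b _ H 3
  simp [(pderiv (2 : Fin 4)).leibniz_pow] at h2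
  simp [(pderiv (3 : Fin 4)).leibniz_pow] at h3
  have hb0 : b 0 = 0 := h2.1
  rw [hb0, sub_zero] at h3
  exact ⟨hb0, h3.1⟩

/-- **`F′` translated to the entry `(0, 1, 0, 0)` is part 5's `x₁^p x₃ + x₂^p x₄`** (`(y₂ + 1)^p − 1 = y₂^p`). [folklore] -/
theorem translate_entry_inst₄ :
    PointBlowup.translate (Function.update (0 : Fin 4 → K) 1 1) (X 0 ^ p * X 2 + (X 1 ^ p - 1) * X 3 : MvPolynomial (Fin 4) K) =
      X 0 ^ p * X 2 + X 1 ^ p * X 3 := by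
  unfold PointBlowup.translate
  simp only [map_add, map_sub, map_mul, map_pow, map_one, aeval_X, Function.update_self,
    Function.update_of_ne (show (0 : Fin 4) ≠ 1 by decide), Function.update_of_ne (show (2 : Fin 4) ≠ 1 by decide),
    Function.update_of_ne (show (3 : Fin 4) ≠ 1 by decide), Pi.zero_apply, map_zero, add_zero]
  rw [add_pow_char, one_pow, add_sub_cancel_right]

/-- `x₁^p x₃ + x₂^p x₄ ≠ F` (the exponent `x₁^{2p} x₃` of `F` is missing on the left). [folklore] -/
theorem inst_ne_inst₄ :
    (X 0 ^ p * X 2 + X 1 ^ p * X 3 : MvPolynomial (Fin 4) K) ≠ X 0 ^ (2 * p) * X 2 + (X 1 - X 0) ^ p * X 3 := by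
  intro h
  have hc := coeff_inst₄_lead (K := K) (p := p)
  rw [← h] at hc
  have hzero : coeff (Finsupp.single (0 : Fin 4) (2 * p) + Finsupp.single 2 1)
      (X 0 ^ p * X 2 + X 1 ^ p * X 3 : MvPolynomial (Fin 4) K) = 0 := by
    by_contra hne
    rcases mem_support_inst (MvPolynomial.mem_support_iff.mpr hne) with h' | h'
    · have := DFunLike.congr_fun h' 0
      simp at this
      exact hp.out.ne_zero (by omega)
    · have := DFunLike.congr_fun h' 2
      simp at this
  rw [hzero] at hc
  exact zero_ne_one hc

/-- **The `F`-component of the child state** `step p {x₁,x₂} x₁ (0,1,0,0) (F, 0, ∅)` is `x₁^p x₃ + x₂^p x₄`.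
[cite: Hauser2010, §§F–G] [cite: HauserPerlega2019PRIMS, §2] -/
theorem step_F_inst₄ [DecidableEq K] :
    (CentreBlowup.step p ({0, 1} : Finset (Fin 4)) 0 (Function.update (0 : Fin 4 → K) 1 1)
        (⟨X 0 ^ (2 * p) * X 2 + (X 1 - X 0) ^ p * X 3, 0, ∅⟩ : State K)).F =
      X 0 ^ p * X 2 + X 1 ^ p * X 3 := by
  show deletePthPowers p (PointBlowup.translate (Function.update (0 : Fin 4 → K) 1 1)
    (CentreBlowup.chartTransform p ({0, 1} : Finset (Fin 4)) 0
      (X 0 ^ (2 * p) * X 2 + (X 1 - X 0) ^ p * X 3 : MvPolynomial (Fin 4) K))) = _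
  rw [chartTransform_inst₄_zero, translate_entry_inst₄]
  exact Literature.Barriers.ResolutionOfSingularities.HauserPerlega.deletePthPowers_eq_self isClean_inst

/-- **The entry `(x₁, (0,1,0,0))` is an equimultiple pair** (its translated transform is `x₁^p x₃ + x₂^p x₄`, no monomial
of degree `< p`). [cite: Hauser2010, §F (equiconstant points)] -/
theorem isEquimultiplePoint_inst₄_entry [DecidableEq K] :
    CentreBlowup.IsEquimultiplePoint p ({0, 1} : Finset (Fin 4)) 0 (Function.update (0 : Fin 4 → K) 1 1)
      (⟨X 0 ^ (2 * p) * X 2 + (X 1 - X 0) ^ p * X 3, 0, ∅⟩ : State K) := by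
  intro d hd hdp
  unfold CentreBlowup.pointTransform
  rw [show (⟨X 0 ^ (2 * p) * X 2 + (X 1 - X 0) ^ p * X 3, 0, ∅⟩ : State K).F =
      X 0 ^ (2 * p) * X 2 + (X 1 - X 0) ^ p * X 3 from rfl, chartTransform_inst₄_zero, translate_entry_inst₄]
  by_contra hne
  rcases mem_support_inst (MvPolynomial.mem_support_iff.mpr hne) with rfl | rfl
  · rw [map_add, Finsupp.degree_single, Finsupp.degree_single] at hdp
    omega
  · rw [map_add, Finsupp.degree_single, Finsupp.degree_single] at hdp
    omega

/-- **In the `x₁`-chart the equimultiple points have `y₂ = 1`** (`∂F′/∂y₄ = y₂^p − 1 = (y₂ − 1)^p`).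
[cite: Hauser2010, §F (equiconstant points)] -/
theorem eq_one_of_isEquimultiplePoint_inst₄ [DecidableEq K] {b : Fin 4 → K}
    (h : CentreBlowup.IsEquimultiplePoint p ({0, 1} : Finset (Fin 4)) 0 b
      (⟨X 0 ^ (2 * p) * X 2 + (X 1 - X 0) ^ p * X 3, 0, ∅⟩ : State K)) : b 1 = 1 := by
  unfold CentreBlowup.IsEquimultiplePoint CentreBlowup.pointTransform at h
  rw [show (⟨X 0 ^ (2 * p) * X 2 + (X 1 - X 0) ^ p * X 3, 0, ∅⟩ : State K).F =
      X 0 ^ (2 * p) * X 2 + (X 1 - X 0) ^ p * X 3 from rfl, chartTransform_inst₄_zero] at h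
  have h3 := eval_pderiv_eq_zero_of_forall_coeff b _ h 3
  simp [(pderiv (3 : Fin 4)).leibniz_pow] at h3
  have h1 : (b 1 - 1) ^ p = 0 := by rw [sub_pow_char, one_pow, sub_eq_zero, ← sub_eq_zero, h3]
  exact sub_eq_zero.mp (pow_eq_zero_iff hp.out.ne_zero |>.mp h1)

/-- **In the `x₂`-chart no NORMALISED pair (`y₁ = 0`) is equimultiple** (`∂F′/∂y₄ = 1 − y₁^p` is `1` there) — the
equimultiple points of this chart (`y₁ = 1`) are the child's points, already listed in the `x₁`-chart.
[cite: Hauser2010, §F (equiconstant points)] -/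
theorem not_isEquimultiplePoint_inst₄_one [DecidableEq K] {b : Fin 4 → K} (hb0 : b 0 = 0) :
    ¬ CentreBlowup.IsEquimultiplePoint p ({0, 1} : Finset (Fin 4)) 1 b
      (⟨X 0 ^ (2 * p) * X 2 + (X 1 - X 0) ^ p * X 3, 0, ∅⟩ : State K) := by
  intro h
  unfold CentreBlowup.IsEquimultiplePoint CentreBlowup.pointTransform at h
  rw [show (⟨X 0 ^ (2 * p) * X 2 + (X 1 - X 0) ^ p * X 3, 0, ∅⟩ : State K).F =
      X 0 ^ (2 * p) * X 2 + (X 1 - X 0) ^ p * X 3 from rfl, chartTransform_inst₄_one] at h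
  have h3 := eval_pderiv_eq_zero_of_forall_coeff b _ h 3
  simp [(pderiv (3 : Fin 4)).leibniz_pow, hb0, hp.out.ne_zero] at h3

end Instance₄

end Equimultiple

end Summit.ResolutionOfSingularities.ResolutionOfSingularities.Theorems.PIDim4

end
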